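import Summits.CriticalPhenomena.PercolationContinuityZ3.Theorems.Transplant.SkelPhiParaRunCoarse
import Summits.CriticalPhenomena.PercolationContinuityZ3.Theorems.Transplant.SkelPhiEquilibriumWDefs
import Summits.CriticalPhenomena.PercolationContinuityZ3.Theorems.Transplant.KNParaChainLocN
import HarnessLib

/-!
# N1 (the `{±1}` node), LEVEL 1, (C) column file (C-N3): SIGNED COARSE READINGS OF A v-STRIDE — the landing `w ∈ pgTopPieceW t n h ℓ R σ τ v` of a
# stride of sign `σ` along `v` from the seed centre `t`, read in hp-8's coarse cell skeleton `ρ = coarseSkel φ t₀ A n h vα vβ c s₀ s₁ D` (λ₀ = (A/n)(m·α −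
# vα·β′), λ₁ = A·β′, m = n·vβ − h·vα): ALONG `σ·Δρ₁ ∈ [⌊cA(nℓ − c_u + 1)/D⌋ − 1, ⌊cA·nℓ/D⌋ + 1]` (`c_u = n + |h|`), ACROSS `σ·Δρ₀` in the SIGN-DEFINITE
# ρ₀-pieces up to floor slack (the `vα·Δβ′` term is kept SIGNED — p1-g11's `lam0_sub_bounds` takes `|Δβ′| ≤ B` and would lose the piece structure,
# HOME/prim-bschramm-p5-g8/C-FUNNEL.md (F-v)); and the TOLERANT landing lemma of the fixed-stride localisation record `ChainPara.LocPrm` that consumes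
# readings with a floor slack `z` (`inCore_succ_of_landing_tol`: walker `z` deeper inside the enlarged core, landing offset in `[−z, Pp]` / `[−Pm, z]`)

builds on p205010 (kernel theorem, internal audit signed; external expert review pending) — nothing in this file uses p205010; nothing here is a
claim about the open node `SamePDropOfSkeletonNeg`.
Lane `prim-bschramm`, seat `prim-bschramm-p5` (gen 8; (C) lineage; phase 1 of the (C) corridor = signed v-rounds over ρ, p3-g8 ruling 13:01Z); helper
file (`--supports stmt-CriticalPhenomena-4575`).
* §1 `neg_ediv_neg_bounds` (`x/D ≤ −((−x)/D) ≤ x/D + 1`), `lam0_sub_bounds_signed`, `coarseSkel_zero_sub_bounds_signed` (from `a₁ ≤ Δα ≤ a₂`, `b₁ ≤ Δβ′ ≤ b₂`);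
* §2 `topPieceW_run_bounds` (`w ∈ pgTopPieceW t n h ℓ R σ τ v` ⇒ `nℓ − c_u + 1 ≤ σΔβ′ ≤ nℓ`, `|Δα| ≤ n`, `τ = 1 → v ≤ σΔα`, `τ = −1 → σΔα ≤ v`);
* §3 **`coarse_landing_v_one`** / **`coarse_landing_v_neg`** (σ = ±1: the `Δρ₁` interval and the `Δρ₀` piece intervals with explicit numerators; the
  consumer symmetrises with `neg_ediv_neg_bounds`);
* §4 `ChainPara.LocPrm.inCore_succ_of_landing_tol`.
[cite: MartineauTassion2017, §4.1, §4.3 Lemma 4.2] [cite: KozmaNitzan2024, §4 Lemma 11 (p. 22), Lemma 12 (pp. 23–25)]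
-/

noncomputable section

namespace Summit.CriticalPhenomena.PercolationContinuityZ3.Theorems.Transplant

namespace Skelφ

open Literature.Probability.Percolation Literature.Probability.LatticeModels SimpleGraph
open TwoAxis.Para (coarse lam0 lam1 modulus)

variable {V : Type} {G : SimpleGraph V} {φ : V → Site 2}

/-! ## §1 Signed bounds for `Δλ₀` and `Δρ₀` -/

omit V G φ in
/-- `x/D ≤ −((−x)/D) ≤ x/D + 1` for `0 < D` (floor vs ceiling). [folklore] -/
theorem neg_ediv_neg_bounds (x : ℤ) {D : ℤ} (hD : 0 < D) : x / D ≤ -((-x) / D) ∧ -((-x) / D) ≤ x / D + 1 := by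
  have h1 := Int.mul_ediv_add_emod x D
  have h2 := Int.mul_ediv_add_emod (-x) D
  have r1 := Int.emod_nonneg x hD.ne'; have r1' := Int.emod_lt_of_pos x hD
  have r2 := Int.emod_nonneg (-x) hD.ne'; have r2' := Int.emod_lt_of_pos (-x) hD
  constructor
  · by_contra hc
    push Not at hc
    have : -((-x) / D) + 1 ≤ x / D := by omega
    nlinarith
  · by_contra hc
    push Not at hc
    have : x / D + 2 ≤ -((-x) / D) := by omega
    nlinarith

/-- **Signed bounds for `Δλ₀`** from `a₁ ≤ Δα ≤ a₂` and `b₁ ≤ Δβ′ ≤ b₂` (`0 ≤ A`, `0 ≤ m`, `1 ≤ n`): with `X₁ = m a₁ − max (vα b₁) (vα b₂)`,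
`X₂ = m a₂ − min (vα b₁) (vα b₂)`: `⌊A X₁/n⌋ ≤ Δλ₀ ≤ ⌊A X₂/n⌋` — the `vα·Δβ′` term kept signed. [folklore] -/
theorem lam0_sub_bounds_signed {A : ℤ} (hA : 0 ≤ A) {n : ℕ} (hn : 1 ≤ n) {h vα vβ : ℤ} (hm : 0 ≤ modulus n h vα vβ) (t c₀ g : V) {a₁ a₂ b₁ b₂ : ℤ}
    (ha1 : a₁ ≤ relCoord φ c₀ 0 g) (ha2 : relCoord φ c₀ 0 g ≤ a₂) (hb1 : b₁ ≤ shearCoord φ c₀ n h g) (hb2 : shearCoord φ c₀ n h g ≤ b₂) :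
    A * (modulus n h vα vβ * a₁ - max (vα * b₁) (vα * b₂)) / n ≤ lam0 A vα vβ (relφ φ t g) - lam0 A vα vβ (relφ φ t c₀) ∧
      lam0 A vα vβ (relφ φ t g) - lam0 A vα vβ (relφ φ t c₀) ≤ A * (modulus n h vα vβ * a₂ - min (vα * b₁) (vα * b₂)) / n := by
  have hn0 : (0 : ℤ) < n := by exact_mod_cast hn
  have e := mul_lam0_sub_origin (φ := φ) A n h vα vβ t c₀ g
  set Δ := lam0 A vα vβ (relφ φ t g) - lam0 A vα vβ (relφ φ t c₀) with hΔ
  set β := shearCoord φ c₀ n h g with hβ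
  -- `min (vα b₁) (vα b₂) ≤ vα β ≤ max (vα b₁) (vα b₂)` whatever the sign of `vα`
  have hv : min (vα * b₁) (vα * b₂) ≤ vα * β ∧ vα * β ≤ max (vα * b₁) (vα * b₂) := by
    rcases le_total 0 vα with hv0 | hv0
    · exact ⟨(min_le_left _ _).trans (mul_le_mul_of_nonneg_left hb1 hv0), (mul_le_mul_of_nonneg_left hb2 hv0).trans (le_max_right _ _)⟩
    · exact ⟨(min_le_right _ _).trans (mul_le_mul_of_nonpos_left hb2 hv0), (mul_le_mul_of_nonpos_left hb1 hv0).trans (le_max_left _ _)⟩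
  have hlo : A * (modulus n h vα vβ * a₁ - max (vα * b₁) (vα * b₂)) ≤ (n : ℤ) * Δ := by
    rw [e]; refine mul_le_mul_of_nonneg_left ?_ hA; nlinarith [hv.2]
  have hhi : (n : ℤ) * Δ ≤ A * (modulus n h vα vβ * a₂ - min (vα * b₁) (vα * b₂)) := by
    rw [e]; refine mul_le_mul_of_nonneg_left ?_ hA; nlinarith [hv.1]
  constructor
  · have h1 := Int.ediv_le_ediv hn0 hlo
    have h2 : (n : ℤ) * Δ / n = Δ := by rw [mul_comm]; exact Int.mul_ediv_cancel Δ hn0.ne'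
    rw [h2] at h1; exact h1
  · exact Int.le_ediv_of_mul_le hn0 (by rw [mul_comm]; exact hhi)

/-- **Signed `Δρ₀` of a vertex** from `a₁ ≤ Δα ≤ a₂`, `b₁ ≤ Δβ′ ≤ b₂`:
`⌊c·⌊A X₁/n⌋/D⌋ ≤ ρ₀(g) − ρ₀(c₀) ≤ ⌊c·⌊A X₂/n⌋/D⌋ + 1` with the signed numerators of `lam0_sub_bounds_signed`. [cite: KozmaNitzan2024, §4 Lemma 11 (p. 22)] -/
theorem coarseSkel_zero_sub_bounds_signed {A : ℤ} (hA : 0 ≤ A) {n : ℕ} (hn : 1 ≤ n) {h vα vβ : ℤ} (hm : 0 ≤ modulus n h vα vβ) {c s₀ s₁ D : ℤ}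
    (hc : 0 ≤ c) (hD : 0 < D) (t c₀ g : V) {a₁ a₂ b₁ b₂ : ℤ}
    (ha1 : a₁ ≤ relCoord φ c₀ 0 g) (ha2 : relCoord φ c₀ 0 g ≤ a₂) (hb1 : b₁ ≤ shearCoord φ c₀ n h g) (hb2 : shearCoord φ c₀ n h g ≤ b₂) :
    (c * (A * (modulus n h vα vβ * a₁ - max (vα * b₁) (vα * b₂)) / n)) / D ≤
        coarseSkel φ t A n h vα vβ c s₀ s₁ D g 0 - coarseSkel φ t A n h vα vβ c s₀ s₁ D c₀ 0 ∧
      coarseSkel φ t A n h vα vβ c s₀ s₁ D g 0 - coarseSkel φ t A n h vα vβ c s₀ s₁ D c₀ 0 ≤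
        (c * (A * (modulus n h vα vβ * a₂ - min (vα * b₁) (vα * b₂)) / n)) / D + 1 := by
  obtain ⟨hl, hu⟩ := lam0_sub_bounds_signed hA hn hm t c₀ g ha1 ha2 hb1 hb2
  have hcs : ∀ w : V, coarseSkel φ t A n h vα vβ c s₀ s₁ D w 0 = coarse c s₀ D (lam0 A vα vβ (relφ φ t w)) := fun w => rfl
  rw [hcs, hcs]
  exact coarse_sub_coarse_bounds hc hD hl hu

/-! ## §2 Run-coordinate bounds of a top-piece landing -/

/-- **Run coordinates of a v-stride landing**: `w ∈ pgTopPieceW t n h ℓ R σ τ v` gives `nℓ − (n+|h|) + 1 ≤ σ·Δβ′ ≤ nℓ`, `|Δα| ≤ n`, and the piece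
`τ = 1 → v ≤ σ·Δα`, `τ = −1 → σ·Δα ≤ v` (`Δ` relative to the seed centre `t`). [cite: MartineauTassion2017, §3.2 (L(v,b), L(−a,v))] -/
theorem topPieceW_run_bounds [G.LocallyFinite] {t : V} {n : ℕ} {h : ℤ} {ℓ R : ℕ} {σ τ v : ℤ} (hσ : σ = 1 ∨ σ = -1) {w : V}
    (hw : w ∈ pgTopPieceW G φ t n h ℓ R σ τ v) :
    (n : ℤ) * ℓ - (n + h.natAbs : ℕ) + 1 ≤ σ * shearCoord φ t n h w ∧ σ * shearCoord φ t n h w ≤ (n : ℤ) * ℓ ∧ |relCoord φ t 0 w| ≤ n ∧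
      (τ = 1 → v ≤ σ * relCoord φ t 0 w) ∧ (τ = -1 → σ * relCoord φ t 0 w ≤ v) := by
  rw [mem_pgTopPieceW] at hw
  obtain ⟨-, hC, hlay, hpc⟩ := hw
  rw [mem_pgramCyl] at hC
  obtain ⟨hα, hβ⟩ := hC
  have hσabs : |σ| = 1 := by rcases hσ with rfl | rfl <;> norm_num
  refine ⟨by omega, ?_, hα, fun hτ => ?_, fun hτ => ?_⟩
  · calc σ * shearCoord φ t n h w ≤ |σ * shearCoord φ t n h w| := le_abs_self _
      _ = |shearCoord φ t n h w| := by rw [abs_mul, hσabs, one_mul]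
      _ ≤ (n : ℤ) * ℓ := hβ
  · subst hτ; linarith
  · subst hτ; linarith

/-! ## §3 The coarse readings of a v-stride -/

section Readings

variable [G.LocallyFinite] {t₀ t : V} {A : ℤ} {n : ℕ} {h vα vβ : ℤ} {c s₀ s₁ D : ℤ} {ℓ R : ℕ} {τ v : ℤ} {w : V}

/-- **Coarse reading of a `+v`-stride** (`σ = 1`): `Δρ₁ ∈ [⌊cA(nℓ − c_u + 1)/D⌋, ⌊cA·nℓ/D⌋ + 1]` and `Δρ₀` in the signed piece intervals:
`τ = 1`: `[⌊c⌊A(m v − max(vα b₁, vα b₂))/n⌋/D⌋, ⌊c⌊A(m n − min(vα b₁, vα b₂))/n⌋/D⌋ + 1]`, `τ = −1`: the same with `(v, n) ↦ (−n, v)`, where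
`b₁ = nℓ − c_u + 1`, `b₂ = nℓ` (`Δρ` of the landing `w` minus that of the seed centre `t`, both about the cell base `t₀`).
[cite: MartineauTassion2017, §4.3 Lemma 4.2] [cite: KozmaNitzan2024, §4 Lemma 11 (p. 22)] -/
theorem coarse_landing_v_one (hA : 0 ≤ A) (hn : 1 ≤ n) (hm : 0 ≤ modulus n h vα vβ) (hc : 0 ≤ c) (hD : 0 < D)
    (hw : w ∈ pgTopPieceW G φ t n h ℓ R 1 τ v) :
    ((c * (A * ((n : ℤ) * ℓ - (n + h.natAbs : ℕ) + 1))) / D ≤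
        coarseSkel φ t₀ A n h vα vβ c s₀ s₁ D w 1 - coarseSkel φ t₀ A n h vα vβ c s₀ s₁ D t 1 ∧
      coarseSkel φ t₀ A n h vα vβ c s₀ s₁ D w 1 - coarseSkel φ t₀ A n h vα vβ c s₀ s₁ D t 1 ≤ (c * (A * ((n : ℤ) * ℓ))) / D + 1) ∧
    (τ = 1 →
      (c * (A * (modulus n h vα vβ * v - max (vα * ((n : ℤ) * ℓ - (n + h.natAbs : ℕ) + 1)) (vα * ((n : ℤ) * ℓ))) / n)) / D ≤
          coarseSkel φ t₀ A n h vα vβ c s₀ s₁ D w 0 - coarseSkel φ t₀ A n h vα vβ c s₀ s₁ D t 0 ∧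
        coarseSkel φ t₀ A n h vα vβ c s₀ s₁ D w 0 - coarseSkel φ t₀ A n h vα vβ c s₀ s₁ D t 0 ≤
          (c * (A * (modulus n h vα vβ * n - min (vα * ((n : ℤ) * ℓ - (n + h.natAbs : ℕ) + 1)) (vα * ((n : ℤ) * ℓ))) / n)) / D + 1) ∧
    (τ = -1 →
      (c * (A * (modulus n h vα vβ * (-(n : ℤ)) - max (vα * ((n : ℤ) * ℓ - (n + h.natAbs : ℕ) + 1)) (vα * ((n : ℤ) * ℓ))) / n)) / D ≤
          coarseSkel φ t₀ A n h vα vβ c s₀ s₁ D w 0 - coarseSkel φ t₀ A n h vα vβ c s₀ s₁ D t 0 ∧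
        coarseSkel φ t₀ A n h vα vβ c s₀ s₁ D w 0 - coarseSkel φ t₀ A n h vα vβ c s₀ s₁ D t 0 ≤
          (c * (A * (modulus n h vα vβ * v - min (vα * ((n : ℤ) * ℓ - (n + h.natAbs : ℕ) + 1)) (vα * ((n : ℤ) * ℓ))) / n)) / D + 1) := by
  obtain ⟨hb1, hb2, hα, hp, hm1⟩ := topPieceW_run_bounds (Or.inl rfl) hw
  simp only [one_mul] at hb1 hb2 hp hm1
  rw [abs_le] at hα
  refine ⟨coarseSkel_one_sub_bounds hA n h vα vβ hc hD t₀ t w hb1 hb2, fun h1 => ?_, fun h1 => ?_⟩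
  · exact coarseSkel_zero_sub_bounds_signed hA hn hm hc hD t₀ t w (hp h1) hα.2 hb1 hb2
  · exact coarseSkel_zero_sub_bounds_signed hA hn hm hc hD t₀ t w (by linarith [hα.1]) (hm1 h1) hb1 hb2

/-- **Coarse reading of a `−v`-stride** (`σ = −1`): `Δβ′ ∈ [−nℓ, −(nℓ − c_u + 1)]`, `Δα ∈ [−n, −v]` (`τ = 1`) / `[−v, n]` (`τ = −1`), hence the
`Δρ₁` interval `[⌊cA(−nℓ)/D⌋, ⌊cA(−(nℓ − c_u + 1))/D⌋ + 1]` and the signed `Δρ₀` piece intervals. [cite: MartineauTassion2017, §4.3 Lemma 4.2] -/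
theorem coarse_landing_v_neg (hA : 0 ≤ A) (hn : 1 ≤ n) (hm : 0 ≤ modulus n h vα vβ) (hc : 0 ≤ c) (hD : 0 < D)
    (hw : w ∈ pgTopPieceW G φ t n h ℓ R (-1) τ v) :
    ((c * (A * (-((n : ℤ) * ℓ)))) / D ≤ coarseSkel φ t₀ A n h vα vβ c s₀ s₁ D w 1 - coarseSkel φ t₀ A n h vα vβ c s₀ s₁ D t 1 ∧
      coarseSkel φ t₀ A n h vα vβ c s₀ s₁ D w 1 - coarseSkel φ t₀ A n h vα vβ c s₀ s₁ D t 1 ≤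
        (c * (A * (-((n : ℤ) * ℓ - (n + h.natAbs : ℕ) + 1)))) / D + 1) ∧
    (τ = 1 →
      (c * (A * (modulus n h vα vβ * (-(n : ℤ)) - max (vα * (-((n : ℤ) * ℓ))) (vα * (-((n : ℤ) * ℓ - (n + h.natAbs : ℕ) + 1)))) / n)) / D ≤
          coarseSkel φ t₀ A n h vα vβ c s₀ s₁ D w 0 - coarseSkel φ t₀ A n h vα vβ c s₀ s₁ D t 0 ∧
        coarseSkel φ t₀ A n h vα vβ c s₀ s₁ D w 0 - coarseSkel φ t₀ A n h vα vβ c s₀ s₁ D t 0 ≤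
          (c * (A * (modulus n h vα vβ * (-v) - min (vα * (-((n : ℤ) * ℓ))) (vα * (-((n : ℤ) * ℓ - (n + h.natAbs : ℕ) + 1)))) / n)) / D + 1) ∧
    (τ = -1 →
      (c * (A * (modulus n h vα vβ * (-v) - max (vα * (-((n : ℤ) * ℓ))) (vα * (-((n : ℤ) * ℓ - (n + h.natAbs : ℕ) + 1)))) / n)) / D ≤
          coarseSkel φ t₀ A n h vα vβ c s₀ s₁ D w 0 - coarseSkel φ t₀ A n h vα vβ c s₀ s₁ D t 0 ∧
        coarseSkel φ t₀ A n h vα vβ c s₀ s₁ D w 0 - coarseSkel φ t₀ A n h vα vβ c s₀ s₁ D t 0 ≤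
          (c * (A * (modulus n h vα vβ * n - min (vα * (-((n : ℤ) * ℓ))) (vα * (-((n : ℤ) * ℓ - (n + h.natAbs : ℕ) + 1)))) / n)) / D + 1) := by
  obtain ⟨hb1, hb2, hα, hp, hm1⟩ := topPieceW_run_bounds (Or.inr rfl) hw
  rw [abs_le] at hα
  have hb1' : -((n : ℤ) * ℓ) ≤ shearCoord φ t n h w := by linarith
  have hb2' : shearCoord φ t n h w ≤ -((n : ℤ) * ℓ - (n + h.natAbs : ℕ) + 1) := by linarith
  refine ⟨coarseSkel_one_sub_bounds hA n h vα vβ hc hD t₀ t w hb1' hb2', fun h1 => ?_, fun h1 => ?_⟩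
  · have := hp h1
    exact coarseSkel_zero_sub_bounds_signed hA hn hm hc hD t₀ t w (by linarith [hα.1]) (by linarith) hb1' hb2'
  · have := hm1 h1
    exact coarseSkel_zero_sub_bounds_signed hA hn hm hc hD t₀ t w (by linarith) hα.2 hb1' hb2'

end Readings

end Skelφ

/-! ## §4 The tolerant landing of the fixed-stride localisation record -/

namespace ChainPara

namespace LocPrm

variable {P : LocPrm}

/-- **Tolerant landing**: if the walker sits `z` inside the enlarged core transversally (`|b| ≤ W + k·e + e − z`, `0 ≤ z`, pieces `+ z ≤ W`), strides
towards the centre with along-progress in `[sLo, sHi]`, and its landing's signed transverse offset lies in the TOLERANT piece `[−z, Pp]` (`τ = 1`) /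
`[−Pm, z]` (`τ = −1`) of the steered sign `τ = steerT (dir a) b`, then the landing lies in core `k + 1` — the form in which coarse (ρ) readings with
floor slack `z` feed the localisation rounds. [cite: KozmaNitzan2024, §4 Lemma 12 (pp. 23–25)] [cite: MartineauTassion2017, §4.3 Lemma 4.2] -/
theorem inCore_succ_of_landing_tol {z : ℤ} (hz : 0 ≤ z) (hzP : (P.Pp : ℤ) + z ≤ P.W) (hzM : (P.Pm : ℤ) + z ≤ P.W)
    {k : ℕ} {a b a' b' : ℤ} (ha : |a| ≤ P.L k + P.e) (hb : |b| ≤ P.Wk k + P.e - z)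
    (h1 : P.sLo ≤ dir a * (a' - a)) (h2 : dir a * (a' - a) ≤ P.sHi)
    (hp1 : steerT (dir a) b = 1 → -z ≤ dir a * (b' - b) ∧ dir a * (b' - b) ≤ P.Pp)
    (hm1 : steerT (dir a) b = -1 → -(P.Pm : ℤ) ≤ dir a * (b' - b) ∧ dir a * (b' - b) ≤ z) :
    P.InCore (k + 1) a' b' := by
  have hWk : (P.W : ℤ) ≤ P.Wk k := by unfold Wk; nlinarith [Int.natCast_nonneg P.e, Int.natCast_nonneg k]
  rw [abs_le] at ha hb
  constructor
  · -- along: as in `inCore_succ_of_landing`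
    rw [L_succ, abs_le]
    by_cases h0 : 0 ≤ a
    · have hd : dir a = -1 := by simp [dir, h0]
      rw [hd] at h1 h2
      constructor
      · have := le_max_right (P.L k + P.e - P.sLo) P.sHi; linarith
      · have := le_max_left (P.L k + P.e - P.sLo) P.sHi; linarith
    · have hd : dir a = 1 := by simp [dir, h0]
      rw [hd] at h1 h2
      push Not at h0
      constructor
      · have := le_max_left (P.L k + P.e - P.sLo) P.sHi; linarith
      · have := le_max_right (P.L k + P.e - P.sLo) P.sHi; linarith
  · -- transverse with tolerance `z`
    rw [Wk_succ, abs_le]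
    by_cases h0 : 0 ≤ a
    · have hd : dir a = -1 := by simp [dir, h0]
      rw [hd] at hp1 hm1
      by_cases hb0 : b ≤ 0
      · have ht : steerT (-1) b = -1 := by unfold steerT; rw [if_pos (by linarith)]
        have := hm1 ht
        constructor <;> nlinarith
      · have ht : steerT (-1) b = 1 := by unfold steerT; rw [if_neg (by linarith)]
        have := hp1 ht
        constructor <;> nlinarith
    · have hd : dir a = 1 := by simp [dir, h0]
      rw [hd] at hp1 hm1
      by_cases hb0 : 0 ≤ b
      · have ht : steerT 1 b = -1 := by unfold steerT; rw [if_pos (by linarith)]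
        have := hm1 ht
        constructor <;> nlinarith
      · have ht : steerT 1 b = 1 := by unfold steerT; rw [if_neg (by linarith)]
        have := hp1 ht
        constructor <;> nlinarith

end LocPrm

end ChainPara

end Summit.CriticalPhenomena.PercolationContinuityZ3.Theorems.Transplant

end
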